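import Mathlib
import Summits.Ventures.PercRepro2.TB14DomZMono

/-!
# Row 2′TB: THE BOTTOM RUNG of the monotone release Hall — an explicit injection
(blind cell PercRepro2, mine-c g22, 2026-08-26; `conjectures/MINE-C.md` §31.6)

The monotone release moves (`TB14DomZMono`) strictly decrease the number of red edges inside the
red cluster of `a₂`, so the monotone bipartite graph is graded.  Its BOTTOM level: the mark-free
sources whose red cluster is exactly `{a₂, o}` (`IsBottomSrc`) and the mark-free targets whose red
cluster is `{a₂}` (`IsBottomTgt`).  The CANONICAL MOVE `bottomMove` — every edge between `a₂` and
`o` turns blue, every other non-loop edge at `o` turns red, nothing else changes — maps the bottom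
sources INJECTIVELY into the bottom targets at the all-free profile:

* in a bottom source every `a₂`–`o` edge is red (a blue one would put `o` into the blue cluster of
  `a₂`), every other non-loop edge at `a₂` or at `o` is blue (the red cluster is `{a₂, o}`);
* after the move the red cluster of `a₂` is `{a₂}`, `o` is blue-joined to `a₂` through an `a₂`–`o`
  edge, and the blue cluster of `a₂` lies inside the old one plus `o` (the recoloured edges at `o`
  are red), so `a₁` stays outside;
* the move is injective on the bottom sources (the recoloured edges had forced colours).

Hence `card_bottomSrc_le_card_bottomTgt`: the bottom count inequality of the graded family, the
first rung of `DomZReleaseMono` proved outright.  Own work; standard axioms.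
-/

namespace Summit.Ventures.PercRepro2

namespace TB14DomZBottom

open CovForm A3InactiveTyped TB14Fold TB14FlipFamily TB14Hall TB14DomZ TB14DomZFree TB14DomZMono

section Defs

variable {V : Type} {E : Type} [DecidableEq E]
variable (ends : E → Sym2 V) (a₁ a₂ o : V) (F : Finset E)

/-- A BOTTOM source: a mark-free source whose red cluster of `a₂` is contained in `{a₂, o}`. -/
def IsBottomSrc (y : Config E) : Prop :=
  IsSrc ends a₁ a₂ a₁ o F y ∧ ∀ v, Conn ends y a₂ v → v = a₂ ∨ v = o

/-- A BOTTOM target: a mark-free target whose red cluster of `a₂` is `{a₂}`. -/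
def IsBottomTgt (y : Config E) : Prop :=
  IsTgt ends a₁ a₂ a₁ o F y ∧ ∀ v, Conn ends y a₂ v → v = a₂

omit [DecidableEq E] in
open Classical in
/-- **The bottom move**: every edge between `a₂` and `o` turns blue, every other non-loop edge at
`o` turns red, every other edge keeps its colour. -/
noncomputable def bottomMove (y : Config E) : Config E := fun e =>
  if o ∈ ends e ∧ a₂ ∈ ends e then false
  else if o ∈ ends e ∧ ¬ (ends e).IsDiag then true
  else y e

end Defs

section Lemmas

variable {V : Type} {E : Type} [DecidableEq E]
variable (ends : E → Sym2 V) (a₁ a₂ o : V)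

/-- The blue copy at the all-free profile is the complement. -/
lemma flipOn_univ [Fintype E] (y : Config E) (e : E) :
    Summit.Ventures.PercRepro2.flipOn Finset.univ y e = !y e := by
  simp [Summit.Ventures.PercRepro2.flipOn]

omit [DecidableEq E] in
/-- An edge between `a₂` and `o` is blue after the bottom move. -/
lemma bottomMove_of_a2o {y : Config E} {e : E} (ho : o ∈ ends e) (ha : a₂ ∈ ends e) :
    bottomMove ends a₂ o y e = false := by
  unfold bottomMove
  rw [if_pos ⟨ho, ha⟩]

omit [DecidableEq E] in
/-- A non-loop edge at `o` not touching `a₂` is red after the bottom move. -/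
lemma bottomMove_of_o {y : Config E} {e : E} (ho : o ∈ ends e) (ha : a₂ ∉ ends e)
    (hd : ¬ (ends e).IsDiag) : bottomMove ends a₂ o y e = true := by
  unfold bottomMove
  rw [if_neg (fun h => ha h.2), if_pos ⟨ho, hd⟩]

omit [DecidableEq E] in
/-- An edge not at `o` keeps its colour under the bottom move. -/
lemma bottomMove_of_not_o {y : Config E} {e : E} (ho : o ∉ ends e) :
    bottomMove ends a₂ o y e = y e := by
  unfold bottomMove
  rw [if_neg (fun h => ho h.1), if_neg (fun h => ho h.1)]

omit [DecidableEq E] in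
/-- A loop not touching `a₂` keeps its colour under the bottom move. -/
lemma bottomMove_of_diag {y : Config E} {e : E} (hd : (ends e).IsDiag) (ha : a₂ ∉ ends e) :
    bottomMove ends a₂ o y e = y e := by
  unfold bottomMove
  rw [if_neg (fun h => ha h.2), if_neg (fun h => h.2 hd)]

omit [DecidableEq E] in
/-- In a configuration whose red cluster of `a₂` lies in `{a₂, o}`, a red edge from `a₂` to a vertex
other than `a₂` goes to `o`. -/
lemma eq_o_of_red_a2 {y : Config E} (hT : ∀ v, Conn ends y a₂ v → v = a₂ ∨ v = o) {e : E} {w : V}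
    (he : y e = true) (hends : ends e = s(a₂, w)) (hw : w ≠ a₂) : w = o := by
  have : Conn ends y a₂ w := conn_of_openAdj ⟨e, he, hends⟩
  rcases hT w this with h | h
  · exact absurd h hw
  · exact h

omit [DecidableEq E] in
/-- In such a configuration with `o` red-joined to `a₂`, a red edge from `o` to a vertex other than
`o` goes to `a₂`. -/
lemma eq_a2_of_red_o {y : Config E} (hT : ∀ v, Conn ends y a₂ v → v = a₂ ∨ v = o)
    (ho : Conn ends y a₂ o) {e : E} {w : V} (he : y e = true) (hends : ends e = s(o, w))
    (hw : w ≠ o) : w = a₂ := by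
  have : Conn ends y a₂ w := conn_trans ho (conn_of_openAdj ⟨e, he, hends⟩)
  rcases hT w this with h | h
  · exact h
  · exact absurd h hw

end Lemmas

section Main

variable {V : Type} {E : Type} [Fintype E] [DecidableEq E]
variable (ends : E → Sym2 V) (a₁ a₂ o : V)

omit [Fintype E] [DecidableEq E] in
/-- The bottom move keeps every edge away from `o`, and the loops at `o` not touching `a₂`. -/
lemma bottomMove_eq_of_not_touch {y : Config E} {e : E}
    (h : ¬ (o ∈ ends e ∧ a₂ ∈ ends e)) (h' : ¬ (o ∈ ends e ∧ ¬ (ends e).IsDiag)) :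
    bottomMove ends a₂ o y e = y e := by
  unfold bottomMove
  rw [if_neg h, if_neg h']

omit [Fintype E] in
/-- `o ≠ a₂` for a mark-free source. -/
lemma o_ne_a2_of_isSrc {F : Finset E} {y : Config E} (hs : IsSrc ends a₁ a₂ a₁ o F y) : o ≠ a₂ :=
  fun h => hs.ho' (by rw [h]; exact conn_refl ends _ a₂)

omit [Fintype E] in
/-- `a₁ ≠ a₂` for a mark-free source. -/
lemma a1_ne_a2_of_isSrc {F : Finset E} {y : Config E} (hs : IsSrc ends a₁ a₂ a₁ o F y) : a₁ ≠ a₂ :=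
  fun h => hs.q₁ (by rw [h]; exact conn_refl ends _ a₂)

omit [Fintype E] in
/-- `a₁ ≠ o` for a mark-free source. -/
lemma a1_ne_o_of_isSrc {F : Finset E} {y : Config E} (hs : IsSrc ends a₁ a₂ a₁ o F y) : a₁ ≠ o :=
  fun h => hs.q₁ (by rw [h]; exact conn_symm hs.ho)

omit [Fintype E] [DecidableEq E] in
/-- An edge containing two distinct vertices joins exactly them. -/
lemma ends_eq_of_mem_mem {e : E} {x z : V} (hx : x ∈ ends e) (hz : z ∈ ends e) (hne : x ≠ z) :
    ends e = s(x, z) :=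
  (Sym2.mem_and_mem_iff hne).1 ⟨hx, hz⟩

/-- In a bottom source every edge between `a₂` and `o` is red. -/
lemma red_of_a2o_of_bottomSrc {y : Config E} (hs : IsBottomSrc ends a₁ a₂ o Finset.univ y) {e : E}
    (ho : o ∈ ends e) (ha : a₂ ∈ ends e) : y e = true := by
  by_contra hne
  have hblue : Summit.Ventures.PercRepro2.flipOn Finset.univ y e = true := by
    rw [flipOn_univ]
    cases h : y e
    · rfl
    · exact absurd h hne
  have hends : ends e = s(a₂, o) :=
    ends_eq_of_mem_mem ends ha ho (o_ne_a2_of_isSrc ends a₁ a₂ o hs.1).symm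
  exact hs.1.ho' (conn_of_openAdj ⟨e, hblue, hends⟩)

omit [Fintype E] [DecidableEq E] in
/-- A non-loop edge at `a₂` joins `a₂` to some other vertex. -/
lemma exists_ends_eq_of_mem {e : E} {x : V} (hx : x ∈ ends e) (hd : ¬ (ends e).IsDiag) :
    ∃ z, z ≠ x ∧ ends e = s(x, z) := by
  refine ⟨Sym2.Mem.other hx, ?_, (Sym2.other_spec hx).symm⟩
  intro h
  apply hd
  rw [← Sym2.other_spec hx, h]
  exact Sym2.mk_isDiag_iff.2 rfl

/-- In a bottom source every non-loop edge at `a₂` not touching `o` is blue. -/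
lemma blue_of_a2_of_bottomSrc {y : Config E} (hs : IsBottomSrc ends a₁ a₂ o Finset.univ y) {e : E}
    (ha : a₂ ∈ ends e) (ho : o ∉ ends e) (hd : ¬ (ends e).IsDiag) : y e = false := by
  by_contra hne
  have hred : y e = true := by
    cases h : y e
    · exact absurd h hne
    · rfl
  obtain ⟨w, hw, hends⟩ := exists_ends_eq_of_mem ends ha hd
  have hwo : w = o := eq_o_of_red_a2 ends a₂ o hs.2 hred hends hw
  apply ho
  rw [hends, ← hwo]
  exact Sym2.mem_mk_right _ _

/-- In a bottom source every non-loop edge at `o` not touching `a₂` is blue. -/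
lemma blue_of_o_of_bottomSrc {y : Config E} (hs : IsBottomSrc ends a₁ a₂ o Finset.univ y) {e : E}
    (ho : o ∈ ends e) (ha : a₂ ∉ ends e) (hd : ¬ (ends e).IsDiag) : y e = false := by
  by_contra hne
  have hred : y e = true := by
    cases h : y e
    · exact absurd h hne
    · rfl
  obtain ⟨w, hw, hends⟩ := exists_ends_eq_of_mem ends ho hd
  have hwa : w = a₂ := eq_a2_of_red_o ends a₂ o hs.2 hs.1.ho hred hends hw
  apply ha
  rw [hends, ← hwa]
  exact Sym2.mem_mk_right _ _

/-- **After the bottom move the red cluster of `a₂` is `{a₂}`.** -/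
lemma eq_a2_of_conn_bottomMove {y : Config E} (hs : IsBottomSrc ends a₁ a₂ o Finset.univ y) {v : V}
    (hv : Conn ends (bottomMove ends a₂ o y) a₂ v) : v = a₂ := by
  have key : v ∈ {x : V | x = a₂} := by
    refine mem_of_conn_of_closed (ends := ends) (ω := bottomMove ends a₂ o y) ?_ rfl hv
    intro x hx z hxz
    obtain ⟨hne, e, he, hends⟩ := openGraph_adj.1 hxz
    have hx' : x = a₂ := hx
    rw [hx'] at hends hne
    have hx2 : a₂ ∈ ends e := by rw [hends]; exact Sym2.mem_mk_left _ _
    have hd : ¬ (ends e).IsDiag := by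
      rw [hends]; exact fun h => hne (Sym2.mk_isDiag_iff.1 h)
    by_cases hoe : o ∈ ends e
    · rw [bottomMove_of_a2o ends a₂ o hoe hx2] at he
      exact absurd he Bool.false_ne_true
    · rw [bottomMove_of_not_o ends a₂ o hoe] at he
      rw [blue_of_a2_of_bottomSrc ends a₁ a₂ o hs hx2 hoe hd] at he
      exact absurd he Bool.false_ne_true
  exact key

/-- In a bottom source there is a red edge between `a₂` and `o`. -/
lemma exists_red_a2o_of_bottomSrc {y : Config E} (hs : IsBottomSrc ends a₁ a₂ o Finset.univ y) :
    ∃ e, y e = true ∧ ends e = s(a₂, o) := by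
  have hne : o ≠ a₂ := o_ne_a2_of_isSrc ends a₁ a₂ o hs.1
  have key : o ∈ {v : V | v = a₂ ∨ ∃ e, y e = true ∧ ends e = s(a₂, o)} := by
    refine mem_of_conn_of_closed (ends := ends) (ω := y) ?_ (Or.inl rfl) hs.1.ho
    intro x hx z hxz
    obtain ⟨hxz', e, he, hends⟩ := openGraph_adj.1 hxz
    rcases hx with hx | hx
    · rw [hx] at hends hxz'
      have hzo : z = o := eq_o_of_red_a2 ends a₂ o hs.2 he hends (Ne.symm hxz')
      rw [hzo] at hends
      exact Or.inr ⟨e, he, hends⟩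
    · exact Or.inr hx
  rcases key with h | h
  · exact absurd h hne
  · exact h

/-- **After the bottom move `o` is blue-joined to `a₂`.** -/
lemma conn_blue_bottomMove_a2_o {y : Config E} (hs : IsBottomSrc ends a₁ a₂ o Finset.univ y) :
    Conn ends (Summit.Ventures.PercRepro2.flipOn Finset.univ (bottomMove ends a₂ o y)) a₂ o := by
  obtain ⟨e, -, hends⟩ := exists_red_a2o_of_bottomSrc ends a₁ a₂ o hs
  have ho : o ∈ ends e := by rw [hends]; exact Sym2.mem_mk_right _ _
  have ha : a₂ ∈ ends e := by rw [hends]; exact Sym2.mem_mk_left _ _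
  have hblue : Summit.Ventures.PercRepro2.flipOn Finset.univ (bottomMove ends a₂ o y) e = true := by
    rw [flipOn_univ, bottomMove_of_a2o ends a₂ o ho ha]
    rfl
  exact conn_of_openAdj ⟨e, hblue, hends⟩

/-- **After the bottom move the blue cluster of `a₂` lies in the old one together with `o`.** -/
lemma conn_blue_bottomMove_subset {y : Config E} (hs : IsBottomSrc ends a₁ a₂ o Finset.univ y)
    {v : V} (hv : Conn ends (Summit.Ventures.PercRepro2.flipOn Finset.univ (bottomMove ends a₂ o y)) a₂ v) :
    Conn ends (Summit.Ventures.PercRepro2.flipOn Finset.univ y) a₂ v ∨ v = o := by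
  have hne : o ≠ a₂ := o_ne_a2_of_isSrc ends a₁ a₂ o hs.1
  have key : v ∈ {x : V | Conn ends (Summit.Ventures.PercRepro2.flipOn Finset.univ y) a₂ x ∨ x = o} := by
    refine mem_of_conn_of_closed (ends := ends)
      (ω := Summit.Ventures.PercRepro2.flipOn Finset.univ (bottomMove ends a₂ o y)) ?_
      (Or.inl (conn_refl ends _ a₂)) hv
    intro x hx z hxz
    obtain ⟨hxz', e, he, hends⟩ := openGraph_adj.1 hxz
    rw [flipOn_univ] at he
    have hred : bottomMove ends a₂ o y e = false := by
      cases h : bottomMove ends a₂ o y e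
      · rfl
      · rw [h] at he; exact absurd he Bool.false_ne_true
    have hxe : x ∈ ends e := by rw [hends]; exact Sym2.mem_mk_left _ _
    have hze : z ∈ ends e := by rw [hends]; exact Sym2.mem_mk_right _ _
    have hd : ¬ (ends e).IsDiag := by
      rw [hends]; exact fun h => hxz' (Sym2.mk_isDiag_iff.1 h)
    by_cases h1 : o ∈ ends e ∧ a₂ ∈ ends e
    · -- the edge joins `a₂` and `o`: `z` is one of them
      have hends' : ends e = s(o, a₂) := ends_eq_of_mem_mem ends h1.1 h1.2 hne
      rw [hends'] at hze
      rcases Sym2.mem_iff.1 hze with hz | hz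
      · exact Or.inr hz
      · exact Or.inl (by rw [hz]; exact conn_refl ends _ a₂)
    · by_cases h2 : o ∈ ends e ∧ ¬ (ends e).IsDiag
      · rw [bottomMove_of_o ends a₂ o h2.1 (fun ha => h1 ⟨h2.1, ha⟩) h2.2] at hred
        exact absurd hred (by decide)
      · rw [bottomMove_eq_of_not_touch ends a₂ o h1 h2] at hred
        have hblue : Summit.Ventures.PercRepro2.flipOn Finset.univ y e = true := by
          rw [flipOn_univ, hred]; rfl
        rcases hx with hx | hx
        · exact Or.inl (conn_trans hx (conn_of_openAdj ⟨e, hblue, hends⟩))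
        · -- `x = o`: the edge touches `o`, so it would have been recoloured unless it is a loop
          exfalso
          subst hx
          exact h2 ⟨hxe, hd⟩
  exact key

/-- **The bottom move of a bottom source is a bottom target.** -/
theorem isBottomTgt_bottomMove {y : Config E} (hs : IsBottomSrc ends a₁ a₂ o Finset.univ y) :
    IsBottomTgt ends a₁ a₂ o Finset.univ (bottomMove ends a₂ o y) := by
  refine ⟨⟨?_, ?_, conn_refl ends _ a₁, conn_blue_bottomMove_a2_o ends a₁ a₂ o hs, ?_⟩,
    fun v hv => eq_a2_of_conn_bottomMove ends a₁ a₂ o hs hv⟩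
  · intro h
    exact a1_ne_a2_of_isSrc ends a₁ a₂ o hs.1
      (eq_a2_of_conn_bottomMove ends a₁ a₂ o hs (conn_symm h))
  · intro h
    rcases conn_blue_bottomMove_subset ends a₁ a₂ o hs (conn_symm h) with h' | h'
    · exact hs.1.q₂ (conn_symm h')
    · exact a1_ne_o_of_isSrc ends a₁ a₂ o hs.1 h'
  · intro h
    exact o_ne_a2_of_isSrc ends a₁ a₂ o hs.1 (eq_a2_of_conn_bottomMove ends a₁ a₂ o hs h)

/-- **The bottom move is injective on the bottom sources.** -/
theorem bottomMove_injOn {y₁ y₂ : Config E} (h₁ : IsBottomSrc ends a₁ a₂ o Finset.univ y₁)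
    (h₂ : IsBottomSrc ends a₁ a₂ o Finset.univ y₂)
    (h : bottomMove ends a₂ o y₁ = bottomMove ends a₂ o y₂) : y₁ = y₂ := by
  funext e
  by_cases ho : o ∈ ends e
  · by_cases ha : a₂ ∈ ends e
    · rw [red_of_a2o_of_bottomSrc ends a₁ a₂ o h₁ ho ha, red_of_a2o_of_bottomSrc ends a₁ a₂ o h₂ ho ha]
    · by_cases hd : (ends e).IsDiag
      · have := congrFun h e
        rwa [bottomMove_of_diag ends a₂ o hd ha, bottomMove_of_diag ends a₂ o hd ha] at this
      · rw [blue_of_o_of_bottomSrc ends a₁ a₂ o h₁ ho ha hd, blue_of_o_of_bottomSrc ends a₁ a₂ o h₂ ho ha hd]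
  · have := congrFun h e
    rwa [bottomMove_of_not_o ends a₂ o ho, bottomMove_of_not_o ends a₂ o ho] at this

open Classical in
/-- **THE BOTTOM COUNT INEQUALITY**: at the all-free profile the sources whose red cluster of `a₂`
lies in `{a₂, o}` are at most as many as the targets whose red cluster of `a₂` is `{a₂}`. -/
theorem card_bottomSrc_le_card_bottomTgt (z : Config E) :
    ((srcSet ends a₁ a₂ a₁ o Finset.univ z).filter
        fun y => ∀ v, Conn ends y a₂ v → v = a₂ ∨ v = o).card ≤
      ((tgtSet ends a₁ a₂ a₁ o Finset.univ z).filter fun y => ∀ v, Conn ends y a₂ v → v = a₂).card := by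
  have hmem : ∀ y, y ∈ (srcSet ends a₁ a₂ a₁ o Finset.univ z).filter
      (fun y => ∀ v, Conn ends y a₂ v → v = a₂ ∨ v = o) → IsBottomSrc ends a₁ a₂ o Finset.univ y := by
    intro y hy
    rw [Finset.mem_filter, srcSet, Finset.mem_filter] at hy
    exact ⟨hy.1.2.2, hy.2⟩
  refine Finset.card_le_card_of_injOn (bottomMove ends a₂ o) ?_ ?_
  · intro y hy
    rw [Finset.mem_coe] at hy ⊢
    have hb := isBottomTgt_bottomMove ends a₁ a₂ o (hmem y hy)
    rw [Finset.mem_filter, tgtSet, Finset.mem_filter]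
    exact ⟨⟨Finset.mem_univ _, fun e he => absurd (Finset.mem_univ e) he, hb.1⟩, hb.2⟩
  · intro y₁ hy₁ y₂ hy₂ h
    exact bottomMove_injOn ends a₁ a₂ o (hmem y₁ (Finset.mem_coe.1 hy₁)) (hmem y₂ (Finset.mem_coe.1 hy₂)) h

end Main

end TB14DomZBottom

end Summit.Ventures.PercRepro2
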